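import Literature.Geometry.Kaehler.ComplexTorusHilbertModularCuspStabilizerSectorCharacters
import Literature.Geometry.Kaehler.ComplexTorusHilbertModularCuspStabilizerSliceRetraction
import Literature.Analysis.FunctionSpaces.TorusFormsDirectionAveraging
import HarnessLib

/-!
# Averaging over the multiplier lattice in the coordinates `w = x + iu`: every class of `H^{k+1}((ℍⁿ, Γ_∞))` is
# represented by `(Θ⁻¹)^*` of a form invariant under `x`- and `i·H₀`-translations
# (Freitag, *Hilbert Modular Forms*, Ch. III §2, proof of Prop. 2.1, pp. 144–145)

Geometry/Kaehler ∕ NumberTheory/Automorphic support file, sequel of `…CuspStabilizerSectorCharacters` (`[ω] = [ω_∅] + [ω_univ]`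
for `x`-independent closed `ω`, and `δ_{log ε}^* ω_I = (sectorChar I ε)⁻¹ ω_I`), of `…CuspStabilizerDilationInvariance` (the
transports `Θ^* = logForm`, `(Θ⁻¹)^* = expForm`, the affine action `logAct` of `Γ_∞` in the coordinates `w = x + iu`) and
of the generic lattice-direction averaging engine `Literature.Analysis.FunctionSpaces.TorusFormsDirectionAveraging`.
Everything proved; definitions with bodies, no named fact.

Freitag (p. 145) averages over the compact torus `D/Γ_∞`; in the coordinates `w = x + iu` (`y = e^u`) the group `Γ_∞` acts
by affine maps (`logAct`) and the multipliers `ε ∈ Λ` act by the TRANSLATIONS `w ↦ w + i log ε` composed with a map fixing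
the imaginary directions. This file feeds the transported form `Θ^*ω` to the engine:

* §1 transport: a smooth form on `ℂ^{Hom(F,ℝ)}` invariant under every `logAct ε m`, `(ε m; 0 ε⁻¹) ∈ Γ_∞`, descends to
  `M_∞(ℍⁿ)^{Γ_∞}` (`expForm_mem_invariantForms_of_forall_pullForm_logAct`, the pattern of
  `expForm_transOperator_mem_invariantForms`);
* §2 `Θ^*ω (w + iℓ) = Θ^*(δ_ℓ^*ω)(w)` (`logForm_add_imagVec`) and `Θ^*ω (w + b) = Θ^*ω (w)` for real `b` and
  `x`-independent `ω` (`logForm_add_realToPoint`); hence `Θ^*ω` is periodic under `i log ε` as soon as `δ_{log ε}^*ω = ω`,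
  which holds for the extreme sector pieces `ω_∅`, `ω_univ` (`dilPullback_logEmb_extremePart`);
* §3 the trace-zero extension `traceZeroExt : logSpace F →ₗ ℝ^{Hom(F,ℝ)}` (`traceZeroExt (logEmbedding u) = logEmb ε`,
  `traceZeroExt_logEmbedding`) and the log-lattice chart `logLatticeChart hΓ : ℝ^{ι₁ ⊕ (Hom(F,ℝ) ⊕ Unit)} ≃L ℂ^{Hom(F,ℝ)}`
  whose lattice directions are `i · traceZeroExt (logLatticeBasisH0 hΓ j)` (`dirVec_logLatticeChart_single`), each of the
  form `i log ε_j` for a multiplier `ε_j` (`exists_upperTri_dirVec_eq`);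
* §4 the engine applied to `η = Θ^*(ω_∅ + ω_univ)`: `η` is smooth, closed, direction-periodic and `logAct`-invariant, so
  `dhom η` transports to an invariant form and **`[ω_∅ + ω_univ] = [(Θ⁻¹)^*(davg η)]`** (`mk_extremePart_eq_mk_expForm_davg`),
  where `davg η` is invariant under all real translations and all translations `i · dirVec` (`davg_logForm_add_realToPoint`,
  `davg_add_dirVec`).

## References

* [Freitag1990] E. Freitag, *Hilbert Modular Forms*, Springer (1990): Ch. III §2, proof of Prop. 2.1, pp. 144–145; Ch. I §2
  Lemma 2.10₁, p. 31.
* [BottTu1982Forms] R. Bott, L. Tu, *Differential Forms in Algebraic Topology*, GTM 82 (1982), §I.4.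
-/

noncomputable section

/- Instance search through the form spaces `Point F [⋀^Fin p]→L[ℝ] ℂ` nests pending instance problems three deep
(see `…HilbertModularInvariantForms`). -/
set_option maxSynthPendingDepth 3

open scoped Matrix MatrixGroups Classical Topology ContDiff

open Set Function Filter Complex ContinuousAlternatingMap

namespace Literature.NumberTheory.Automorphic.HilbertModular

open _root_.NumberField _root_.NumberField.InfinitePlace _root_.NumberField.Units _root_.NumberField.Units.dirichletUnitTheorem
open Module
open Literature.Geometry.Kaehler.ComplexTorus.HilbertModularFamily
open Literature.NumberTheory.Automorphic (HilbertModular.deRhamCohomology.mk HilbertModular.deRhamCohomology.mk_eq_mk_iff)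
open Literature.Analysis.FunctionSpaces (Torus.dirVec Torus.dirVec_apply Torus.IsDirPeriodic Torus.davg Torus.dhom
  Torus.stdWeight Torus.isNormalisedWeight_stdWeight Torus.hasPolyGrowthWeight_stdWeight Torus.contDiff_davg Torus.contDiff_dhom
  Torus.extDeriv_dhom Torus.davg_add_dirVec Torus.davg_eq_comp_of_invariant Torus.dhom_eq_comp_of_invariant Torus.joinE
  Torus.joinE_apply_inl Torus.joinE_apply_inr)

variable {F : Type*} [Field F] [NumberField F] [IsTotallyReal F]

/-! ## §1 Transport of `logAct`-invariant forms to `M_∞(ℍⁿ)^{Γ_∞}` -/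

section Transport

variable {Γ : Subgroup SL(2, F)} {k : ℕ}

omit [IsTotallyReal F] in
/-- **A smooth form on `ℂ^{Hom(F,ℝ)}` invariant under the affine maps `logAct ε m` of `Γ_∞` transports to an invariant
form `(Θ⁻¹)^*Θ'` on `ℍⁿ`.** [cite: Freitag1990, Ch. III §2, p. 144; BottTu1982Forms, §I.4] -/
theorem expForm_mem_invariantForms_of_forall_pullForm_logAct {Θ' : Form F k} (hΘ : ContDiff ℝ ∞ Θ')
    (hinv : ∀ (e : Fˣ) (m : F), upperTri e m ∈ stabInfty Γ → pullForm (logAct e m) Θ' = Θ') :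
    expForm Θ' ∈ invariantForms (stabInfty Γ) k := by
  refine ⟨contDiffOn_expForm hΘ, fun γ hγ z hz ↦ ?_, fun z hz ↦ expForm_of_not_mem _ hz⟩
  obtain ⟨e, -, -, hγe⟩ := exists_eq_upperTri_of_apply_one_zero ((mem_stabInfty_iff Γ γ).1 hγ).2
  have hmem : upperTri e (γ 0 1) ∈ stabInfty Γ := hγe ▸ hγ
  have hγz : moeb γ z ∈ halfSpace F := moeb_mem_halfSpace γ hz
  have hev : (logIm ∘ moeb γ : Point F → Point F) =ᶠ[𝓝 z] (logAct e (γ 0 1) ∘ logIm) := by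
    filter_upwards [isOpen_halfSpace.mem_nhds hz] with y hy
    simp only [Function.comp_apply]
    conv_lhs => rw [hγe, ← expIm_logIm hy, moeb_upperTri_expIm, logIm_expIm]
  have hD : (fderiv ℝ logIm (moeb γ z)).comp (fderiv ℝ (moeb γ) z) = (logActL e).comp (fderiv ℝ logIm z) := by
    rw [← fderiv_comp z (differentiableAt_logIm hγz) ((hasFDerivAt_moeb γ hz).restrictScalars ℝ).differentiableAt,
      hev.fderiv_eq, fderiv_comp z (hasFDerivAt_logAct e _ _).differentiableAt (differentiableAt_logIm hz), fderiv_logAct]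
  have hpt : logIm (moeb γ z) = logAct e (γ 0 1) (logIm z) := hev.self_of_nhds
  have hDv : ∀ u : Point F, fderiv ℝ logIm (moeb γ z) (fderiv ℝ (moeb γ) z u) = logActL e (fderiv ℝ logIm z u) := fun u ↦
    congrArg (fun T : Point F →L[ℝ] Point F ↦ T u) hD
  rw [moebPullback_def, expForm_of_mem _ hγz, expForm_of_mem _ hz]
  ext v
  have key' := congrArg (fun Ψ : Form F k ↦ Ψ (logIm z) fun i ↦ fderiv ℝ logIm z (v i)) (hinv e _ hmem)
  simp only [pullForm_apply, fderiv_logAct] at key'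
  simp only [ContinuousAlternatingMap.compContinuousLinearMap_apply, Function.comp_def, hDv, hpt]
  exact key'

end Transport

/-! ## §2 `Θ^*ω` under imaginary and real translations -/

section Translations

variable {Γ : Subgroup SL(2, F)} {k : ℕ}

omit [NumberField F] [IsTotallyReal F] in
/-- `Θ(w + b) = Θ(w) + b` for a real vector `b`. [cite: Freitag1990, Ch. I §2 Lemma 2.10₁, p. 31] -/
theorem expIm_add_realToPoint (w : Point F) (b : (F →+* ℝ) → ℝ) :
    expIm (w + realToPoint F b) = expIm w + realToPoint F b := by
  funext σ
  apply Complex.ext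
  · simp [expIm_apply_re]
  · simp [expIm_apply_im]

omit [IsTotallyReal F] in
/-- `DΘ(w + b) = DΘ(w)` for a real vector `b`. [cite: Freitag1990, Ch. I §2 Lemma 2.10₁, p. 31] -/
theorem fderiv_expIm_add_realToPoint (w : Point F) (b : (F →+* ℝ) → ℝ) :
    fderiv ℝ expIm (w + realToPoint F b) = fderiv ℝ (expIm : Point F → Point F) w := by
  have h : (fun w : Point F => expIm (w + realToPoint F b)) = fun w => expIm w + realToPoint F b :=
    funext fun w => expIm_add_realToPoint w b
  rw [← fderiv_comp_add_right, h, fderiv_add_const]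

omit [IsTotallyReal F] in
/-- `DΘ(w + iℓ) = δ_ℓ ∘ DΘ(w)`. [cite: Freitag1990, Ch. I §2 Lemma 2.10₁, p. 31] -/
theorem fderiv_expIm_add_imagVec (w : Point F) (ℓ : (F →+* ℝ) → ℝ) :
    fderiv ℝ expIm (w + imagVec ℓ) = (dilateL ℓ).comp (fderiv ℝ (expIm : Point F → Point F) w) := by
  have h : (fun w : Point F => expIm (w + imagVec ℓ)) = dilateL ℓ ∘ expIm :=
    funext fun w => expIm_add_imagVec w ℓ
  rw [← fderiv_comp_add_right, h, fderiv_comp w (dilateL ℓ).differentiableAt (differentiable_expIm w), (dilateL ℓ).fderiv]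

omit [IsTotallyReal F] in
/-- **`Θ^*ω (w + iℓ) = Θ^*(δ_ℓ^*ω)(w)`**: imaginary translations in `w` are the dilations `δ_ℓ`.
[cite: Freitag1990, Ch. III §2, p. 144] -/
theorem logForm_add_imagVec (α : Form F k) (w : Point F) (ℓ : (F →+* ℝ) → ℝ) :
    logForm α (w + imagVec ℓ) = logForm (dilPullback ℓ α) w := by
  rw [logForm_apply_eq, logForm_apply_eq, expIm_add_imagVec, fderiv_expIm_add_imagVec,
    dilPullback_of_mem ℓ α (expIm_mem_halfSpace w)]
  ext v
  rfl

omit [IsTotallyReal F] in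
/-- **`Θ^*ω (w + b) = Θ^*ω (w)`** for real `b` and an `x`-independent `ω`. [cite: Freitag1990, Ch. III §2, p. 145] -/
theorem logForm_add_realToPoint {α : Form F k} (hαx : ∀ z x, α (z + realToPoint F x) = α z) (w : Point F)
    (b : (F →+* ℝ) → ℝ) : logForm α (w + realToPoint F b) = logForm α w := by
  rw [logForm_apply_eq, logForm_apply_eq, expIm_add_realToPoint, hαx, fderiv_expIm_add_realToPoint]

/-- **The extreme part `ω_∅ + ω_univ`** of a form: the sum of its two sector pieces with trivial multiplier characters.
[cite: Freitag1990, Ch. III §2, proof of Prop. 2.1, p. 145] -/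
def extremePart (α : Form F k) : Form F k :=
  sectorPiece α ∅ + sectorPiece α Finset.univ

omit [IsTotallyReal F] in
/-- The extreme part is `x`-independent when `ω` is (its coefficients are the `f_t`, `c_t` depends on `y` only).
[cite: Freitag1990, Ch. III §2, p. 145] -/
theorem sectorPiece_add_realToPoint {α : Form F k} (hαx : ∀ z x, α (z + realToPoint F x) = α z) (I : Finset (F →+* ℝ))
    (z : Point F) (x : (F →+* ℝ) → ℝ) : sectorPiece α I (z + realToPoint F x) = sectorPiece α I z := by
  rw [sectorPiece_apply, sectorPiece_apply]
  refine Finset.sum_congr rfl fun t _ => ?_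
  rw [formCoeff_add_realToPoint hαx]
  congr 1
  by_cases hz : z ∈ halfSpace F
  · have hz' : z + realToPoint F x ∈ halfSpace F := (add_realToPoint_mem_halfSpace_iff z x).2 hz
    refine eq_of_apply_frameTuple_eq hz' fun t' => ?_
    rw [coordForm_apply_frameTuple hz', frameTuple_add_realToPoint, coordForm_apply_frameTuple hz]
  · have hz' : z + realToPoint F x ∉ halfSpace F := fun h => hz ((add_realToPoint_mem_halfSpace_iff z x).1 h)
    rw [coordForm_of_not_mem _ hz, coordForm_of_not_mem _ hz']

omit [IsTotallyReal F] in
/-- `extremePart ω` is `x`-independent for `x`-independent `ω`. [cite: Freitag1990, Ch. III §2, p. 145] -/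
theorem extremePart_add_realToPoint {α : Form F k} (hαx : ∀ z x, α (z + realToPoint F x) = α z) (z : Point F)
    (x : (F →+* ℝ) → ℝ) : extremePart α (z + realToPoint F x) = extremePart α z := by
  simp only [extremePart, Pi.add_apply, sectorPiece_add_realToPoint hαx]

omit [NumberField F] [IsTotallyReal F] in
/-- `sectorChar ∅ ε = 1`. [cite: Freitag1990, Ch. III §2, p. 145] -/
theorem sectorChar_empty (ε : F) : sectorChar (∅ : Finset (F →+* ℝ)) ε = 1 := by
  simp [sectorChar_apply]

/-- `sectorChar univ ε = N(ε) = 1` for a multiplier of a group with cusp `∞`. [cite: Freitag1990, Ch. I §2 Remark 2.3, p. 27] -/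
theorem sectorChar_univ_eq_one (hΓ : HasCuspInfty Γ) {e : Fˣ} {m : F} (hγ : upperTri e m ∈ Γ) :
    sectorChar (Finset.univ : Finset (F →+* ℝ)) ((e ^ 2 : Fˣ) : F) = 1 := by
  have hε : e ^ 2 ∈ multiplierGroup Γ := (mem_multiplierGroup_iff Γ _).2 ⟨e, m, hγ, rfl⟩
  rw [sectorChar_apply, ← Fintype.prod_equiv (realPlaceEquiv F) (fun v => realEmb F v ((e ^ 2 : Fˣ) : F))
    (fun σ => σ ((e ^ 2 : Fˣ) : F)) fun v => rfl]
  exact hΓ.prod_realEmb_eq_one hε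

/-- **`δ_{log ε}^* (ω_∅ + ω_univ) = ω_∅ + ω_univ`** for an `x`-independent invariant `ω` and a multiplier `ε = e²` of a group
with cusp `∞`. [cite: Freitag1990, Ch. III §2, proof of Prop. 2.1, p. 145] -/
theorem dilPullback_logEmb_extremePart (hΓ : HasCuspInfty Γ) {α : Form F k} (hα : α ∈ invariantForms (stabInfty Γ) k)
    (hαx : ∀ z x, α (z + realToPoint F x) = α z) {e : Fˣ} {m : F} (hγ : upperTri e m ∈ Γ) :
    dilPullback (logEmb ((e ^ 2 : Fˣ) : F)) (extremePart α) = extremePart α := by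
  have hlin : ∀ (β β' : Form F k) (ℓ : (F →+* ℝ) → ℝ), dilPullback ℓ (β + β') = dilPullback ℓ β + dilPullback ℓ β' := by
    intro β β' ℓ
    funext z
    by_cases hz : z ∈ halfSpace F
    · rw [dilPullback_of_mem _ _ hz, Pi.add_apply, Pi.add_apply, dilPullback_of_mem _ _ hz, dilPullback_of_mem _ _ hz]
      ext v; simp
    · rw [dilPullback_of_not_mem _ _ hz, Pi.add_apply, dilPullback_of_not_mem _ _ hz, dilPullback_of_not_mem _ _ hz, add_zero]
  rw [extremePart, hlin, dilPullback_logEmb_sectorPiece hα hαx hγ ∅, dilPullback_logEmb_sectorPiece hα hαx hγ Finset.univ,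
    sectorChar_empty, sectorChar_univ_eq_one hΓ hγ, inv_one, Complex.ofReal_one, one_smul, one_smul]

/-- **`Θ^*(ω_∅ + ω_univ)` is periodic under `w ↦ w + i log ε`** for every multiplier `ε = e²`.
[cite: Freitag1990, Ch. III §2, proof of Prop. 2.1, p. 145] -/
theorem logForm_extremePart_add_imagVec_logEmb (hΓ : HasCuspInfty Γ) {α : Form F k}
    (hα : α ∈ invariantForms (stabInfty Γ) k) (hαx : ∀ z x, α (z + realToPoint F x) = α z) {e : Fˣ} {m : F}
    (hγ : upperTri e m ∈ Γ) (w : Point F) :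
    logForm (extremePart α) (w + imagVec (logEmb ((e ^ 2 : Fˣ) : F))) = logForm (extremePart α) w := by
  rw [logForm_add_imagVec, dilPullback_logEmb_extremePart hΓ hα hαx hγ]

end Translations

/-! ## §3 The trace-zero extension and the log-lattice chart -/

section Chart

variable {Γ : Subgroup SL(2, F)}

variable (F) in
/-- The real place of the distinguished infinite place `w₀`. [folklore] -/
private def basePl : RealPlace F := ⟨w₀, IsTotallyReal.isReal _⟩

omit [NumberField F] [IsTotallyReal F] in
/-- `v(x) = |x^{(v)}|` for a real place. [folklore] -/
private theorem realPlace_apply_eq_abs'' (v : RealPlace F) (x : F) : v.1 x = |realEmb F v x| := by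
  rw [← norm_embedding_eq, show (embedding v.1) x = ((realEmb F v x : ℝ) : ℂ) from
    (embedding_of_isReal_apply v.2 x).symm, Complex.norm_real, Real.norm_eq_abs]

/-- Every real place is `w₀` or `placeOf w` for a place `w ≠ w₀`. [folklore] -/
private theorem realPlace_eq_basePl_or (v : RealPlace F) :
    v = basePl F ∨ ∃ w : {w : InfinitePlace F // w ≠ w₀}, v = placeOf w := by
  by_cases h : v.1 = w₀
  · exact Or.inl (Subtype.ext h)
  · exact Or.inr ⟨⟨v.1, h⟩, Subtype.ext rfl⟩

/-- A sum over the real places splits as the `w₀`-term plus the sum over the places `≠ w₀`. [folklore] -/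
private theorem sum_realPlace_eq' (g : RealPlace F → ℝ) :
    ∑ v, g v = g (basePl F) + ∑ w : {w : InfinitePlace F // w ≠ w₀}, g (placeOf w) := by
  let e : RealPlace F ≃ InfinitePlace F := Equiv.subtypeUnivEquiv fun w : InfinitePlace F => IsTotallyReal.isReal w
  rw [← Fintype.sum_equiv e.symm (fun w => g (e.symm w)) g fun _ => rfl, ← Finset.add_sum_erase _ _ (Finset.mem_univ w₀),
    Finset.sum_subtype (Finset.univ.erase w₀) (p := fun w => w ≠ w₀) (fun w => by simp)
      (f := fun w => g (e.symm w))]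
  rfl

omit [NumberField F] [IsTotallyReal F] in
/-- `(realPlaceEquiv)⁻¹ (realEmb v) = v`. [folklore] -/
private theorem realPlaceEquiv_symm_realEmb (v : RealPlace F) : (realPlaceEquiv F).symm (realEmb F v) = v := by
  rw [← realPlaceEquiv_apply, Equiv.symm_apply_apply]

variable (F) in
/-- **The trace-zero extension** of a vector of Mathlib's logarithmic space (coordinates the places `w ≠ w₀`) to a vector
indexed by all real embeddings: the `w₀`-coordinate is minus the sum of the others (Freitag's `log Λ ⊂ {Σ = 0} ⊂ ℝⁿ`).
[cite: Freitag1990, Ch. I §2 2.3–2.4, p. 28] -/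
def traceZeroExt : logSpace F →ₗ[ℝ] ((F →+* ℝ) → ℝ) where
  toFun ℓ σ := if h : ((realPlaceEquiv F).symm σ).1 = w₀ then -∑ w, ℓ w else ℓ ⟨((realPlaceEquiv F).symm σ).1, h⟩
  map_add' ℓ ℓ' := funext fun σ => by
    by_cases h : ((realPlaceEquiv F).symm σ).1 = w₀
    · simp only [dif_pos h, Pi.add_apply, Finset.sum_add_distrib, neg_add]
    · simp only [dif_neg h, Pi.add_apply]
  map_smul' r ℓ := funext fun σ => by
    by_cases h : ((realPlaceEquiv F).symm σ).1 = w₀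
    · simp only [dif_pos h, Pi.smul_apply, smul_eq_mul, RingHom.id_apply, Finset.mul_sum, mul_neg]
    · simp only [dif_neg h, Pi.smul_apply, smul_eq_mul, RingHom.id_apply]

/-- The extension at an embedding `≠ σ₀` is the corresponding coordinate. [cite: Freitag1990, Ch. I §2 2.4, p. 28] -/
theorem traceZeroExt_apply_realEmb_placeOf (ℓ : logSpace F) (w : {w : InfinitePlace F // w ≠ w₀}) :
    traceZeroExt F ℓ (realEmb F (placeOf w)) = ℓ w := by
  change (if h : ((realPlaceEquiv F).symm (realEmb F (placeOf w))).1 = w₀ then -∑ w, ℓ w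
    else ℓ ⟨((realPlaceEquiv F).symm (realEmb F (placeOf w))).1, h⟩) = ℓ w
  simp only [realPlaceEquiv_symm_realEmb]
  rw [dif_neg (show (placeOf w).1 ≠ w₀ from w.2)]
  exact congrArg ℓ (Subtype.ext rfl)

/-- The extension at `σ₀` is minus the sum of the coordinates. [cite: Freitag1990, Ch. I §2 2.4, p. 28] -/
private theorem traceZeroExt_apply_realEmb_basePl (ℓ : logSpace F) : traceZeroExt F ℓ (realEmb F (basePl F)) = -∑ w, ℓ w := by
  change (if h : ((realPlaceEquiv F).symm (realEmb F (basePl F))).1 = w₀ then -∑ w, ℓ w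
    else ℓ ⟨((realPlaceEquiv F).symm (realEmb F (basePl F))).1, h⟩) = -∑ w, ℓ w
  simp only [realPlaceEquiv_symm_realEmb]
  rw [dif_pos (show (basePl F).1 = w₀ from rfl)]

/-- **The extension has trace zero**: `Σ_σ traceZeroExt ℓ σ = 0`. [cite: Freitag1990, Ch. I §2 2.3, p. 28] -/
theorem sum_traceZeroExt (ℓ : logSpace F) : ∑ σ, traceZeroExt F ℓ σ = 0 := by
  rw [← Fintype.sum_equiv (realPlaceEquiv F) (fun v => traceZeroExt F ℓ (realEmb F v)) _ fun v => rfl,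
    sum_realPlace_eq', traceZeroExt_apply_realEmb_basePl]
  simp only [traceZeroExt_apply_realEmb_placeOf, neg_add_cancel]

/-- The extension is injective. [cite: Freitag1990, Ch. I §2 2.4, p. 28] -/
theorem traceZeroExt_injective : Function.Injective (traceZeroExt F) := fun ℓ ℓ' h => funext fun w => by
  rw [← traceZeroExt_apply_realEmb_placeOf ℓ w, ← traceZeroExt_apply_realEmb_placeOf ℓ' w, h]

/-- **The extension of the logarithmic embedding of a unit over `Λ(Γ)` is the full log-vector `(log σ(ε))_σ`** (`N(ε) = 1` for a
group with cusp `∞`). [cite: Freitag1990, Ch. I §2 Remark 2.3 and 2.4, pp. 27–28] -/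
theorem traceZeroExt_logEmbedding (hΓ : HasCuspInfty Γ) {u : (𝓞 F)ˣ} (hu : u ∈ multiplierUnits Γ) :
    traceZeroExt F (logEmbedding F (Additive.ofMul u)) = logEmb ((Units.map (algebraMap (𝓞 F) F : 𝓞 F →* F) u : Fˣ) : F) := by
  set ε : Fˣ := Units.map (algebraMap (𝓞 F) F : 𝓞 F →* F) u with hε_def
  have hε : ε ∈ multiplierGroup Γ := (mem_multiplierUnits_iff Γ u).1 hu
  have hpos : ∀ v : RealPlace F, 0 < realEmb F v (ε : F) := fun v => realEmb_pos_of_mem_multiplierGroup hε v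
  have hlog : ∀ w : {w : InfinitePlace F // w ≠ w₀},
      logEmbedding F (Additive.ofMul u) w = Real.log (realEmb F (placeOf w) (ε : F)) := fun w => by
    rw [logEmbedding_component, IsTotallyReal.mult_eq, Nat.cast_one, one_mul]
    show Real.log (w.1 ((u : 𝓞 F) : F)) = _
    rw [show w.1 = (placeOf w).1 from rfl, realPlace_apply_eq_abs'' (placeOf w),
      show (((u : (𝓞 F)ˣ) : 𝓞 F) : F) = (ε : F) from rfl, abs_of_pos (hpos _)]
  have hsum0 : Real.log (realEmb F (basePl F) (ε : F)) +
      ∑ w : {w : InfinitePlace F // w ≠ w₀}, Real.log (realEmb F (placeOf w) (ε : F)) = 0 := by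
    rw [← sum_realPlace_eq' (fun v => Real.log (realEmb F v (ε : F))), ← Real.log_prod (s := Finset.univ)
      (f := fun v => realEmb F v (ε : F)) (fun v _ => (hpos v).ne'), hΓ.prod_realEmb_eq_one hε, Real.log_one]
  funext σ
  rw [logEmb_apply]
  rcases realPlace_eq_basePl_or ((realPlaceEquiv F).symm σ) with h | ⟨w, hw⟩
  · have hσ : σ = realEmb F (basePl F) := by rw [← realEmb_realPlaceEquiv_symm (F := F) σ, h]
    rw [hσ, traceZeroExt_apply_realEmb_basePl]
    simp only [hlog]
    linarith
  · have hσ : σ = realEmb F (placeOf w) := by rw [← realEmb_realPlaceEquiv_symm (F := F) σ, hw]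
    rw [hσ, traceZeroExt_apply_realEmb_placeOf, hlog]

variable (F) in
/-- **The index type `{1, …, n−1}` of a `ℤ`-basis of `log Λ(Γ) ≅ ℤⁿ⁻¹`.** [cite: Freitag1990, Ch. I §2 2.5 («`Λ ≅ ℤⁿ⁻¹`»), p. 28] -/
abbrev LogLatticeIdx : Type := Fin (Fintype.card (F →+* ℝ) - 1)

/-- `#LogLatticeIdx + 1 = n`. [cite: Freitag1990, Ch. I §2 2.5, p. 28] -/
theorem card_logLatticeIdx_add_one : Fintype.card (LogLatticeIdx F) + 1 = Fintype.card (F →+* ℝ) := by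
  haveI : Nonempty (F →+* ℝ) := ⟨realEmb F (basePl F)⟩
  have : 0 < Fintype.card (F →+* ℝ) := Fintype.card_pos
  rw [Fintype.card_fin]
  omega

/-- The index of Mathlib's chosen `ℤ`-basis of `log Λ(Γ)` has `n − 1` elements. [cite: Freitag1990, Ch. I §2 2.5, p. 28] -/
theorem card_chooseBasisIndex_logMultiplierLattice (hΓ : HasCuspInfty Γ) :
    haveI := hΓ.isZLattice_logMultiplierLattice
    Fintype.card (Module.Free.ChooseBasisIndex ℤ (logMultiplierLattice Γ)) = Fintype.card (F →+* ℝ) - 1 := by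
  haveI := hΓ.isZLattice_logMultiplierLattice
  have h1 := Module.finrank_eq_card_basis hΓ.logMultiplierBasis
  rw [Units.finrank_eq_rank] at h1
  rw [← h1, Units.rank, ← Fintype.card_congr (Equiv.subtypeUnivEquiv fun w : InfinitePlace F => IsTotallyReal.isReal w),
    Fintype.card_congr (realPlaceEquiv F)]

/-- **A `ℤ`-basis `B_1, …, B_{n−1}` of `log Λ(Γ)`** (an `ℝ`-basis of the logarithmic space; `hΓ.logMultiplierBasis` reindexed by
`{1, …, n−1}`). [cite: Freitag1990, Ch. I §2 2.5 and Lemma 2.10₁ (proof), pp. 28, 31] -/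
def logLatticeBasisH0 (hΓ : HasCuspInfty Γ) : Module.Basis (LogLatticeIdx F) ℝ (logSpace F) :=
  haveI := hΓ.isZLattice_logMultiplierLattice
  hΓ.logMultiplierBasis.reindex (Fintype.equivFinOfCardEq (card_chooseBasisIndex_logMultiplierLattice hΓ))

/-- The vectors `B_j` lie in `log Λ(Γ)`. [cite: Freitag1990, Ch. I §2 2.5, p. 28] -/
theorem logLatticeBasisH0_mem (hΓ : HasCuspInfty Γ) (j : LogLatticeIdx F) : logLatticeBasisH0 hΓ j ∈ logMultiplierLattice Γ := by
  haveI := hΓ.isZLattice_logMultiplierLattice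
  rw [logLatticeBasisH0, Module.Basis.reindex_apply]
  have h := Submodule.subset_span (R := ℤ) (Set.mem_range_self (f := ⇑hΓ.logMultiplierBasis)
    ((Fintype.equivFinOfCardEq (card_chooseBasisIndex_logMultiplierLattice hΓ)).symm j))
  rwa [hΓ.span_logMultiplierBasis] at h

/-- **The log-lattice frame of `ℂ^{Hom(F,ℝ)}` over `ℝ`**: the imaginary vectors `i · log ε_j` of a `ℤ`-basis of `log Λ(Γ)`,
the real unit vectors `e_σ`, and the diagonal `i𝟙`. [cite: Freitag1990, Ch. III §2, p. 144 («`(x_1,…,x_n, log y_1, …, log y_{n−1})`»)] -/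
def logLatticeFrame (hΓ : HasCuspInfty Γ) : LogLatticeIdx F ⊕ ((F →+* ℝ) ⊕ Unit) → Point F :=
  Sum.elim (fun j => imagVec (traceZeroExt F (logLatticeBasisH0 hΓ j)))
    (Sum.elim (fun σ => realToPoint F (Pi.single σ 1)) fun _ => imagVec fun _ => 1)

omit [NumberField F] [IsTotallyReal F] in
/-- `imagVec` is additive. [folklore] -/
private theorem imagVec_add (ℓ ℓ' : (F →+* ℝ) → ℝ) : imagVec (ℓ + ℓ') = imagVec ℓ + imagVec ℓ' := by
  funext σ; simp [imagVec, add_mul]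

omit [NumberField F] [IsTotallyReal F] in
/-- `imagVec` is homogeneous. [folklore] -/
private theorem imagVec_smul (r : ℝ) (ℓ : (F →+* ℝ) → ℝ) : imagVec (r • ℓ) = (r : ℝ) • imagVec ℓ := by
  funext σ; simp [imagVec, Complex.real_smul, mul_assoc]

omit [NumberField F] [IsTotallyReal F] in
/-- `imagVec` of a sum. [folklore] -/
private theorem imagVec_sum {ι : Type*} (s : Finset ι) (ℓ : ι → (F →+* ℝ) → ℝ) :
    imagVec (∑ i ∈ s, ℓ i) = ∑ i ∈ s, imagVec (ℓ i) := by
  induction s using Finset.induction_on with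
  | empty => funext σ; simp [imagVec]
  | insert a s ha ih => rw [Finset.sum_insert ha, Finset.sum_insert ha, imagVec_add, ih]

omit [NumberField F] [IsTotallyReal F] in
/-- `imagVec` is injective. [folklore] -/
private theorem imagVec_injective : Function.Injective (imagVec : ((F →+* ℝ) → ℝ) → Point F) := fun ℓ ℓ' h =>
  funext fun σ => by rw [← imagVec_apply_im ℓ σ, ← imagVec_apply_im ℓ' σ, h]

/-- **The log-lattice frame is linearly independent.** [cite: Freitag1990, Ch. III §2, p. 144] -/
theorem linearIndependent_logLatticeFrame (hΓ : HasCuspInfty Γ) : LinearIndependent ℝ (logLatticeFrame hΓ) := by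
  rw [Fintype.linearIndependent_iff]
  intro g hg
  rw [Fintype.sum_sum_type, Fintype.sum_sum_type] at hg
  simp only [logLatticeFrame, Sum.elim_inl, Sum.elim_inr, Finset.univ_unique, Finset.sum_singleton] at hg
  -- real parts: the coefficients of the `e_σ` vanish
  have hre : ∀ τ : F →+* ℝ, g (Sum.inr (Sum.inl τ)) = 0 := fun τ => by
    have h := congrArg (fun v : Point F => (v τ).re) hg
    simpa [Finset.sum_apply, Pi.smul_apply, Complex.real_smul, imagVec, realToPoint_apply, Pi.single_apply] using h
  -- imaginary parts
  have him : ∀ τ : F →+* ℝ, ∑ j, g (Sum.inl j) * traceZeroExt F (logLatticeBasisH0 hΓ j) τ + g (Sum.inr (Sum.inr default)) = 0 :=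
    fun τ => by
    have h := congrArg (fun v : Point F => (v τ).im) hg
    simpa [Finset.sum_apply, Pi.smul_apply, Complex.real_smul, imagVec, realToPoint_apply] using h
  -- summing over `τ`: the diagonal coefficient vanishes
  have hdiag : g (Sum.inr (Sum.inr default)) = 0 := by
    have h := Finset.sum_eq_zero (s := Finset.univ) fun τ _ => him τ
    rw [Finset.sum_add_distrib, Finset.sum_comm, Finset.sum_const, Finset.card_univ, nsmul_eq_mul] at h
    simp only [← Finset.mul_sum, sum_traceZeroExt, mul_zero, Finset.sum_const_zero, zero_add] at h
    haveI : Nonempty (F →+* ℝ) := ⟨realEmb F (basePl F)⟩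
    have hn : (Fintype.card (F →+* ℝ) : ℝ) ≠ 0 := by exact_mod_cast Fintype.card_ne_zero
    exact (mul_eq_zero.1 h).resolve_left hn
  -- the lattice coefficients vanish
  have hlat : ∀ j, g (Sum.inl j) = 0 := by
    have h0 : traceZeroExt F (∑ j, g (Sum.inl j) • logLatticeBasisH0 hΓ j) = 0 := by
      funext τ
      rw [_root_.map_sum, Finset.sum_apply]
      have := him τ
      rw [hdiag, add_zero] at this
      simpa [_root_.map_smul, Pi.smul_apply, smul_eq_mul] using this
    have h1 : ∑ j, g (Sum.inl j) • logLatticeBasisH0 hΓ j = 0 :=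
      traceZeroExt_injective (by rw [h0, _root_.map_zero])
    exact Fintype.linearIndependent_iff.1 (logLatticeBasisH0 hΓ).linearIndependent _ h1
  rintro (j | σ | u)
  · exact hlat j
  · exact hre σ
  · cases u; exact hdiag

/-- **The log-lattice basis of `ℂ^{Hom(F,ℝ)}` over `ℝ`** (the frame has `(n−1) + n + 1 = 2n` members).
[cite: Freitag1990, Ch. III §2, p. 144] -/
def logLatticeBasis (hΓ : HasCuspInfty Γ) : Module.Basis (LogLatticeIdx F ⊕ ((F →+* ℝ) ⊕ Unit)) ℝ (Point F) :=
  haveI : Nonempty (F →+* ℝ) := ⟨realEmb F (basePl F)⟩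
  basisOfLinearIndependentOfCardEqFinrank (linearIndependent_logLatticeFrame hΓ) (by
    rw [Fintype.card_sum, Fintype.card_sum, Fintype.card_unit, finrank_real_point]
    have := card_logLatticeIdx_add_one (F := F)
    omega)

/-- The log-lattice basis consists of the frame vectors. [cite: Freitag1990, Ch. III §2, p. 144] -/
@[simp]
theorem logLatticeBasis_apply (hΓ : HasCuspInfty Γ) (i : LogLatticeIdx F ⊕ ((F →+* ℝ) ⊕ Unit)) :
    logLatticeBasis hΓ i = logLatticeFrame hΓ i := by
  haveI : Nonempty (F →+* ℝ) := ⟨realEmb F (basePl F)⟩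
  rw [logLatticeBasis, coe_basisOfLinearIndependentOfCardEqFinrank]

/-- **The log-lattice chart `Φ : ℝ^{ι₁ ⊕ (Hom(F,ℝ) ⊕ Unit)} ≃L ℂ^{Hom(F,ℝ)}`**, `Φ(c) = Σ_i c_i • frame_i`.
[cite: Freitag1990, Ch. III §2, p. 144] -/
def logLatticeChart (hΓ : HasCuspInfty Γ) : EuclideanSpace ℝ (LogLatticeIdx F ⊕ ((F →+* ℝ) ⊕ Unit)) ≃L[ℝ] Point F :=
  ((EuclideanSpace.equiv (LogLatticeIdx F ⊕ ((F →+* ℝ) ⊕ Unit)) ℝ).toLinearEquiv.trans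
    (logLatticeBasis hΓ).equivFun.symm).toContinuousLinearEquiv

/-- `Φ(c) = Σ_i c_i • frame_i`. [cite: Freitag1990, Ch. III §2, p. 144] -/
theorem logLatticeChart_apply (hΓ : HasCuspInfty Γ) (c : EuclideanSpace ℝ (LogLatticeIdx F ⊕ ((F →+* ℝ) ⊕ Unit))) :
    logLatticeChart hΓ c = ∑ i, c i • logLatticeFrame hΓ i := by
  change (logLatticeBasis hΓ).equivFun.symm (EuclideanSpace.equiv _ ℝ c) = _
  rw [Module.Basis.equivFun_symm_apply]
  simp only [logLatticeBasis_apply]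
  rfl

/-- **The lattice directions of the chart are the imaginary vectors `i · traceZeroExt (Σ_j s_j B_j)`.**
[cite: Freitag1990, Ch. III §2, p. 144] -/
theorem dirVec_logLatticeChart (hΓ : HasCuspInfty Γ) (s : EuclideanSpace ℝ (LogLatticeIdx F)) :
    Torus.dirVec (logLatticeChart hΓ) s = imagVec (traceZeroExt F (∑ j, s j • logLatticeBasisH0 hΓ j)) := by
  rw [Torus.dirVec_apply]
  change logLatticeChart hΓ (Torus.joinE s 0) = _
  rw [logLatticeChart_apply, Fintype.sum_sum_type, _root_.map_sum, imagVec_sum]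
  simp only [logLatticeFrame, Sum.elim_inl, Sum.elim_inr, Torus.joinE_apply_inl, Torus.joinE_apply_inr, _root_.map_smul,
    imagVec_smul]
  simp

/-- The linear parts `logActL ε` of `Γ_∞` fix the lattice directions. [cite: Freitag1990, Ch. I §2 Lemma 2.10₁, p. 31] -/
theorem logActL_dirVec_logLatticeChart (hΓ : HasCuspInfty Γ) (e : Fˣ) (s : EuclideanSpace ℝ (LogLatticeIdx F)) :
    logActL e (Torus.dirVec (logLatticeChart hΓ) s) = Torus.dirVec (logLatticeChart hΓ) s := by
  rw [dirVec_logLatticeChart, logActL_imagVec]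

/-- **Each basis direction is `i log ε_j` for a multiplier `ε_j = e_j²` of `Γ`.** [cite: Freitag1990, Ch. I §2 2.5, p. 28] -/
theorem exists_upperTri_dirVec_single_eq (hΓ : HasCuspInfty Γ) (j : LogLatticeIdx F) :
    ∃ (e : Fˣ) (m : F), upperTri e m ∈ Γ ∧
      Torus.dirVec (logLatticeChart hΓ) (EuclideanSpace.single j 1) = imagVec (logEmb ((e ^ 2 : Fˣ) : F)) := by
  have hmem : logLatticeBasisH0 hΓ j ∈ logMultiplierLattice Γ := logLatticeBasisH0_mem hΓ j
  obtain ⟨u, hu, hlog⟩ := (mem_logMultiplierLattice_iff Γ _).1 hmem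
  set ε : Fˣ := Units.map (algebraMap (𝓞 F) F : 𝓞 F →* F) u
  obtain ⟨e, m, hγ, hεe⟩ := (mem_multiplierGroup_iff Γ ε).1 ((mem_multiplierUnits_iff Γ u).1 hu)
  refine ⟨e, m, hγ, ?_⟩
  rw [dirVec_logLatticeChart]
  have hs : (∑ j', (EuclideanSpace.single j (1 : ℝ) : EuclideanSpace ℝ (LogLatticeIdx F)) j' • logLatticeBasisH0 hΓ j') =
      logLatticeBasisH0 hΓ j := by
    simp [Finset.sum_ite_eq', ite_smul]
  rw [hs, ← hlog, traceZeroExt_logEmbedding hΓ hu, ← hεe]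

end Chart

/-! ## §4 The engine applied: `[ω_∅ + ω_univ] = [(Θ⁻¹)^*(davg Θ^*(ω_∅ + ω_univ))]` -/

section Engine

variable {Γ : Subgroup SL(2, F)} {k : ℕ}

omit [IsTotallyReal F] in
/-- The extreme part of an invariant form is invariant. [cite: Freitag1990, Ch. III §2, p. 145] -/
theorem extremePart_mem_invariantForms {α : Form F k} (hα : α ∈ invariantForms (stabInfty Γ) k) :
    extremePart α ∈ invariantForms (stabInfty Γ) k :=
  Submodule.add_mem _ (sectorPiece_mem_invariantForms hα ∅) (sectorPiece_mem_invariantForms hα Finset.univ)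

omit [IsTotallyReal F] in
/-- The extreme part of an `x`-independent closed form is closed. [cite: Freitag1990, Ch. III §2, p. 145] -/
theorem extremePart_mem_closedForms {α : Form F k} (hα : α ∈ closedForms (stabInfty Γ) k)
    (hαx : ∀ z x, α (z + realToPoint F x) = α z) : extremePart α ∈ closedForms (stabInfty Γ) k :=
  Submodule.add_mem _ (sectorPiece_mem_closedForms hα hαx ∅) (sectorPiece_mem_closedForms hα hαx Finset.univ)

/-- **`η = Θ^*(ω_∅ + ω_univ)` is periodic under the lattice directions of the log-lattice chart.**
[cite: Freitag1990, Ch. III §2, proof of Prop. 2.1, p. 145] -/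
theorem isDirPeriodic_logForm_extremePart (hΓ : HasCuspInfty Γ) {α : Form F k} (hα : α ∈ invariantForms (stabInfty Γ) k)
    (hαx : ∀ z x, α (z + realToPoint F x) = α z) :
    Torus.IsDirPeriodic (logLatticeChart hΓ) (logForm (extremePart α)) := by
  intro j q
  obtain ⟨e, m, hγ, hdir⟩ := exists_upperTri_dirVec_single_eq hΓ j
  rw [hdir, logForm_extremePart_add_imagVec_logEmb hΓ hα hαx hγ]

omit [IsTotallyReal F] in
/-- `Θ^*ω` is invariant under the affine maps of `Γ_∞` in the form the engine wants: `η(q) = η(Lq + c) ∘ L`.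
[cite: Freitag1990, Ch. III §2, p. 145 («invariant under `z ↦ εz + b`»)] -/
theorem logForm_eq_comp_logActL {α : Form F k} (hα : α ∈ invariantForms (stabInfty Γ) k) {e : Fˣ} {m : F}
    (hγ : upperTri e m ∈ stabInfty Γ) (q : Point F) :
    logForm α q = (logForm α (logActL e q + logAct e m 0)).compContinuousLinearMap (logActL e) := by
  have h := congrFun (pullForm_logAct_logForm hα.2.1 hγ) q
  rw [pullForm_apply_eq, fderiv_logAct] at h
  rw [← h, show logAct e m q = logActL e q + logAct e m 0 from congrFun (logAct_eq_add e m) q]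

variable (hΓ : HasCuspInfty Γ)

/-- **The lattice homotopy `h = dhom Φ W Θ^*(ω_∅ + ω_univ)`** of the transported extreme part (standard weights).
[cite: Freitag1990, Ch. III §2, proof of Prop. 2.1, p. 145; BottTu1982Forms, §I.4] -/
def logHom (α : Form F (k + 1)) : Form F k :=
  Torus.dhom (logLatticeChart hΓ) Torus.stdWeight (logForm (extremePart α))

/-- **The lattice average `A = davg Φ Θ^*(ω_∅ + ω_univ)`** of the transported extreme part.
[cite: Freitag1990, Ch. III §2, proof of Prop. 2.1, p. 145] -/
def logAvg (α : Form F k) : Form F k :=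
  Torus.davg (logLatticeChart hΓ) (logForm (extremePart α))

variable {hΓ}

omit [IsTotallyReal F] in
/-- `Θ^*(ω_∅ + ω_univ)` is smooth. [cite: Freitag1990, Ch. III §2, p. 142] -/
theorem contDiff_logForm_extremePart {α : Form F k} (hα : α ∈ invariantForms (stabInfty Γ) k) :
    ContDiff ℝ ∞ (logForm (extremePart α)) :=
  contDiff_logForm (extremePart_mem_invariantForms hα).1

/-- The lattice homotopy is smooth. [cite: BottTu1982Forms, §I.4] -/
theorem contDiff_logHom {α : Form F (k + 1)} (hα : α ∈ invariantForms (stabInfty Γ) (k + 1))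
    (hαx : ∀ z x, α (z + realToPoint F x) = α z) : ContDiff ℝ ∞ (logHom hΓ α) :=
  Torus.contDiff_dhom Torus.isNormalisedWeight_stdWeight Torus.hasPolyGrowthWeight_stdWeight
    (contDiff_logForm_extremePart hα) (isDirPeriodic_logForm_extremePart hΓ hα hαx)

/-- The lattice average is smooth. [cite: BottTu1982Forms, §I.4] -/
theorem contDiff_logAvg {α : Form F k} (hα : α ∈ invariantForms (stabInfty Γ) k) (hαx : ∀ z x, α (z + realToPoint F x) = α z) :
    ContDiff ℝ ∞ (logAvg hΓ α) :=
  Torus.contDiff_davg (contDiff_logForm_extremePart hα) (isDirPeriodic_logForm_extremePart hΓ hα hαx)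

/-- **The lattice homotopy is invariant under the affine maps of `Γ_∞`** (engine equivariance: the linear parts fix the
directions). [cite: Freitag1990, Ch. III §2, p. 145; BottTu1982Forms, §I.4] -/
theorem pullForm_logAct_logHom {α : Form F (k + 1)} (hα : α ∈ invariantForms (stabInfty Γ) (k + 1))
    (hαx : ∀ z x, α (z + realToPoint F x) = α z) {e : Fˣ} {m : F} (hγ : upperTri e m ∈ stabInfty Γ) :
    pullForm (logAct e m) (logHom hΓ α) = logHom hΓ α := by
  funext q
  rw [pullForm_apply_eq, fderiv_logAct, logHom]
  conv_lhs => rw [logAct_eq_add]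
  exact (Torus.dhom_eq_comp_of_invariant Torus.hasPolyGrowthWeight_stdWeight
    (contDiff_logForm_extremePart (extremePart_mem_invariantForms hα |> fun _ => hα))
    (isDirPeriodic_logForm_extremePart hΓ hα hαx) (logActL_dirVec_logLatticeChart hΓ e)
    (logForm_eq_comp_logActL (extremePart_mem_invariantForms hα) hγ) q).symm

/-- **The lattice average is invariant under the affine maps of `Γ_∞`.** [cite: Freitag1990, Ch. III §2, p. 145] -/
theorem pullForm_logAct_logAvg {α : Form F k} (hα : α ∈ invariantForms (stabInfty Γ) k)
    (hαx : ∀ z x, α (z + realToPoint F x) = α z) {e : Fˣ} {m : F} (hγ : upperTri e m ∈ stabInfty Γ) :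
    pullForm (logAct e m) (logAvg hΓ α) = logAvg hΓ α := by
  funext q
  rw [pullForm_apply_eq, fderiv_logAct, logAvg]
  conv_lhs => rw [logAct_eq_add]
  exact (Torus.davg_eq_comp_of_invariant (contDiff_logForm_extremePart hα)
    (isDirPeriodic_logForm_extremePart hΓ hα hαx) (logActL_dirVec_logLatticeChart hΓ e)
    (logForm_eq_comp_logActL (extremePart_mem_invariantForms hα) hγ) q).symm

/-- **`(Θ⁻¹)^* h ∈ M^k_∞(ℍⁿ)^{Γ_∞}`.** [cite: Freitag1990, Ch. III §2, proof of Prop. 2.1, p. 145] -/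
theorem expForm_logHom_mem_invariantForms {α : Form F (k + 1)} (hα : α ∈ invariantForms (stabInfty Γ) (k + 1))
    (hαx : ∀ z x, α (z + realToPoint F x) = α z) : expForm (logHom hΓ α) ∈ invariantForms (stabInfty Γ) k :=
  expForm_mem_invariantForms_of_forall_pullForm_logAct (contDiff_logHom hα hαx) fun _ _ hγ => pullForm_logAct_logHom hα hαx hγ

/-- **`(Θ⁻¹)^* A ∈ M^k_∞(ℍⁿ)^{Γ_∞}`.** [cite: Freitag1990, Ch. III §2, proof of Prop. 2.1, p. 145] -/
theorem expForm_logAvg_mem_invariantForms {α : Form F k} (hα : α ∈ invariantForms (stabInfty Γ) k)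
    (hαx : ∀ z x, α (z + realToPoint F x) = α z) : expForm (logAvg hΓ α) ∈ invariantForms (stabInfty Γ) k :=
  expForm_mem_invariantForms_of_forall_pullForm_logAct (contDiff_logAvg hα hαx) fun _ _ hγ => pullForm_logAct_logAvg hα hαx hγ

omit [NumberField F] [IsTotallyReal F] in
/-- `(Θ⁻¹)^*` is compatible with differences. [folklore] -/
private theorem expForm_sub (Θ₁ Θ₂ : Form F k) : expForm (Θ₁ - Θ₂) = expForm Θ₁ - expForm Θ₂ := by
  funext z
  by_cases hz : z ∈ halfSpace F
  · rw [Pi.sub_apply, expForm_of_mem _ hz, expForm_of_mem _ hz, expForm_of_mem _ hz, Pi.sub_apply]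
    ext v; simp
  · rw [expForm_of_not_mem _ hz, Pi.sub_apply, expForm_of_not_mem _ hz, expForm_of_not_mem _ hz, sub_zero]

omit [IsTotallyReal F] in
/-- `(Θ⁻¹)^* Θ^* ω = ω` for a form vanishing off `ℍⁿ`. [cite: Freitag1990, Ch. I §2 Lemma 2.10₁, p. 31] -/
theorem expForm_logForm_eq {α : Form F k} (hα0 : ∀ z ∉ halfSpace F, α z = 0) : expForm (logForm α) = α := by
  funext z
  by_cases hz : z ∈ halfSpace F
  · exact expForm_logForm α hz
  · rw [expForm_of_not_mem _ hz, hα0 z hz]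

/-- **THE HOMOTOPY FORMULA ON `ℍⁿ`: `(ω_∅ + ω_univ) − (Θ⁻¹)^* A = d((Θ⁻¹)^* h)`** for an `x`-independent
`ω ∈ closedForms Γ_∞ (k+1)`. [cite: Freitag1990, Ch. III §2, proof of Prop. 2.1, p. 145; BottTu1982Forms, §I.4] -/
theorem extremePart_sub_expForm_logAvg_eq_extD {α : Form F (k + 1)} (hα : α ∈ closedForms (stabInfty Γ) (k + 1))
    (hαx : ∀ z x, α (z + realToPoint F x) = α z) :
    extremePart α - expForm (logAvg hΓ α) = extD (expForm (logHom hΓ α)) := by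
  have hαi : α ∈ invariantForms (stabInfty Γ) (k + 1) := closedForms_le_invariantForms _ _ hα
  have hE := extremePart_mem_closedForms hα hαx
  have hEi : extremePart α ∈ invariantForms (stabInfty Γ) (k + 1) := closedForms_le_invariantForms _ _ hE
  have hη : ContDiff ℝ ∞ (logForm (extremePart α)) := contDiff_logForm_extremePart hαi
  have hper := isDirPeriodic_logForm_extremePart hΓ hαi hαx
  have hd : ∀ w, extDeriv (logForm (extremePart α)) w = 0 := fun w =>
    congrFun (extDeriv_logForm_eq_zero hE) w
  have hformula : extDeriv (logHom hΓ α) = logForm (extremePart α) - logAvg hΓ α :=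
    funext fun w => Torus.extDeriv_dhom Torus.isNormalisedWeight_stdWeight Torus.hasPolyGrowthWeight_stdWeight hη hper hd w
  rw [extD_expForm (contDiff_logHom hαi hαx), hformula, expForm_sub, expForm_logForm_eq hEi.2.2]

/-- **`(Θ⁻¹)^* A ∈ closedForms Γ_∞ (k+1)`.** [cite: Freitag1990, Ch. III §2, proof of Prop. 2.1, p. 145] -/
theorem expForm_logAvg_mem_closedForms {α : Form F (k + 1)} (hα : α ∈ closedForms (stabInfty Γ) (k + 1))
    (hαx : ∀ z x, α (z + realToPoint F x) = α z) : expForm (logAvg hΓ α) ∈ closedForms (stabInfty Γ) (k + 1) := by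
  have hex : extremePart α - expForm (logAvg hΓ α) ∈ exactForms (stabInfty Γ) (k + 1) := by
    rw [extremePart_sub_expForm_logAvg_eq_extD hα hαx, mem_exactForms_succ_iff]
    exact ⟨_, expForm_logHom_mem_invariantForms (closedForms_le_invariantForms _ _ hα) hαx, rfl⟩
  have h := Submodule.sub_mem _ (extremePart_mem_closedForms hα hαx) (exactForms_le_closedForms _ _ hex)
  rwa [sub_sub_cancel] at h
set_option maxHeartbeats 400000 in -- buildfix (bf3-g31): 160k/180k FAIL, 200k PASS at accept time; line-neutral budget line
/-- **`[ω] = [(Θ⁻¹)^* davg Θ^*(ω_∅ + ω_univ)]` in `H^{k+1}((ℍⁿ, Γ_∞))`** for every `x`-independent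
`ω ∈ closedForms Γ_∞ (k+1)` of a group with cusp `∞`: the class is represented by the transport of the LATTICE AVERAGE
of the extreme part. [cite: Freitag1990, Ch. III §2, proof of Prop. 2.1, p. 145] -/
theorem mk_eq_mk_expForm_logAvg {α : Form F (k + 1)} (hα : α ∈ closedForms (stabInfty Γ) (k + 1))
    (hαx : ∀ z x, α (z + realToPoint F x) = α z) :
    HilbertModular.deRhamCohomology.mk (stabInfty Γ) (k + 1) ⟨α, hα⟩ =
      HilbertModular.deRhamCohomology.mk (stabInfty Γ) (k + 1)
        ⟨expForm (logAvg hΓ α), expForm_logAvg_mem_closedForms hα hαx⟩ := by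
  rw [mk_eq_mk_sectorPiece_empty_add_univ hΓ hα hαx, ← _root_.map_add]
  refine (HilbertModular.deRhamCohomology.mk_eq_mk_iff _ _ _).2 ?_
  change extremePart α - expForm (logAvg hΓ α) ∈ exactForms (stabInfty Γ) (k + 1)
  rw [extremePart_sub_expForm_logAvg_eq_extD hα hαx, mem_exactForms_succ_iff]
  exact ⟨_, expForm_logHom_mem_invariantForms (closedForms_le_invariantForms _ _ hα) hαx, rfl⟩

/-- **The lattice average is invariant under every lattice direction `i · traceZeroExt(Σ s_j B_j)`** (hence under
`i · H₀`, the directions spanning the trace-zero hyperplane). [cite: Freitag1990, Ch. III §2, p. 145] -/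
theorem logAvg_add_dirVec {α : Form F k} (hα : α ∈ invariantForms (stabInfty Γ) k) (hαx : ∀ z x, α (z + realToPoint F x) = α z)
    (q : Point F) (s : EuclideanSpace ℝ (LogLatticeIdx F)) :
    logAvg hΓ α (q + Torus.dirVec (logLatticeChart hΓ) s) = logAvg hΓ α q :=
  Torus.davg_add_dirVec (isDirPeriodic_logForm_extremePart hΓ hα hαx) q s

/-- **The lattice average is invariant under real translations.** [cite: Freitag1990, Ch. III §2, p. 145] -/
theorem logAvg_add_realToPoint {α : Form F k} (hα : α ∈ invariantForms (stabInfty Γ) k)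
    (hαx : ∀ z x, α (z + realToPoint F x) = α z) (q : Point F) (b : (F →+* ℝ) → ℝ) :
    logAvg hΓ α (q + realToPoint F b) = logAvg hΓ α q := by
  have h := Torus.davg_eq_comp_of_invariant (D := ContinuousLinearMap.id ℝ (Point F)) (c := realToPoint F b)
    (contDiff_logForm_extremePart hα) (isDirPeriodic_logForm_extremePart hΓ hα hαx) (fun _ => rfl)
    (fun q' => by
      rw [ContinuousLinearMap.id_apply, logForm_add_realToPoint (extremePart_add_realToPoint hαx)]
      ext v; rfl) q
  rw [logAvg, h, ContinuousLinearMap.id_apply]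
  ext v; rfl

end Engine

end Literature.NumberTheory.Automorphic.HilbertModular
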